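import Summits.ValiantsHypothesis.ValiantsHypothesis.Theorems.BarrierLeverChowStarveTinv
import Summits.ValiantsHypothesis.ValiantsHypothesis.Theorems.BarrierLeverChowStarveSums

/-!
# Route BarrierLever — item 20195 `ChowHitsThinRowPartitionMinors` is FALSE, IV: the ROW-DEPENDENCE
# CERTIFICATE (the partition matrix of any product of affine forms is singular on starved columns)

Helper file (`--supports stmt-ValiantsHypothesis-20195`; cell valiant-natproofs, rung V4, 𝒟-side;
seat val-np-p2 gen 9).  Closes NO item; definition-free.  Core of the kernel REFUTATION of items
20195 / 20172 / 20239 (memo HOME/val-np-p2/g9/REFUTATION-20195-valnp2-g9.md, §2 Step 1).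

For a product `∏_k ℓ_k` of `h + h` affine forms with constant term `1`, `x`-coefficients `A k a` and
`y`-coefficients `B k c`, put `𝕄 a c = Σ_k A k a · B k c` and let `N` be ANY symmetric zero-diagonal
`h × h` matrix with `Σ_{a,b} A k a · N a b · A k b = 0` for every form `k`.  Then the row vector
`λ_∅ = ½ Σ_{k,k'} ν k k'`, `λ_{a} = -Σ_b N a b · Σ_j A j b`, `λ_{a,b} = ½ N a b`
(`ν k k' = Σ_{a,b} A k a · N a b · A k' b`) ANNIHILATES every column `T` of the partition matrix
(`coeff (E U T) ∏ℓ`, rows `U` of size `≤ 2`) such that `|T| ≤ 3`, `Σ_{a,b} N a b · 𝕄 a c · 𝕄 b c' = 0`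
for all distinct `c, c' ∈ T`, and `N · 𝕄 e = 0` for every `e ∈ T` when `|T| = 3`:

* `thinRows_certificate` — `λ_∅ · coeff (E ∅ T) ∏ℓ + Σ_a λ_a · coeff (E {a} T) ∏ℓ
    + Σ_a Σ_{b ≠ a} ½ N a b · coeff (E {a,b} T) ∏ℓ = 0`.

Mechanism: by the row formulas of `…ChowStarveRows` and `…ChowStarveTinv`, the combination equals
`coeff (E ∅ T) (F · Z)` with `F = ∏_k (1 + Σ_c B k c y_c)` and
`Z = ½ Σ_{k,k'} ν k k' · (t_k - 1)(t_{k'} - 1)` (`certificate_algebra`, `coeff_F_mul_Z`); since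
`t_k - 1` has no constant term, the coefficients of `Z` on sets of size `≤ 1` vanish, on pairs they are
`Σ N 𝕄 𝕄`-sums and on triples `Σ H N 𝕄`-sums, all killed by the hypotheses (`coeff_Z_eq_zero`).

WHAT THIS IS NOT: the existence of such `N ≠ 0` and the assembly of the refutation (sequel files);
nothing on item 19717, on crux stmt-ValiantsHypothesis-14610, or on `VP` versus `VNP`.
-/

set_option linter.dupNamespace false

namespace Summit.ValiantsHypothesis.ValiantsHypothesis.Theorems.BarrierLever.ChowStarve

open Finset MvPolynomial
open Summit.ValiantsHypothesis.ValiantsHypothesis.Theorems.BarrierLever.ChowFactor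
  (coeff_partitionExpo_mul_yOnly support_castAdd_eq_zero_of_vars)
open Summit.ValiantsHypothesis.ValiantsHypothesis.Theorems.BarrierLever.ChowCube
  (coeff_tinv coeff_mul_tinv_mul_affineY castAdd_notMem_vars_tinv)

variable {h : ℕ}

/-! ## 5. The element `Z` and the vanishing of its coefficients on admissible sets -/

/-- **The coefficients of `Z = ½ Σ_{k,k'} ν k k' (t_k - 1)(t_{k'} - 1)` vanish on every admissible
set `d`** (`|d| ≤ 3`, pair and triple conditions). -/
theorem coeff_Z_eq_zero (A B : Fin (h + h) → Fin h → ℂ) (N : Fin h → Fin h → ℂ)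
    (hNsym : ∀ a b, N a b = N b a)
    (d : Finset (Fin h)) (hd : d.card ≤ 3)
    (hpair : ∀ c ∈ d, ∀ c' ∈ d, c ≠ c' →
      ∑ a, ∑ b, N a b * (∑ k, A k a * B k c) * (∑ k, A k b * B k c') = 0)
    (htrip : d.card = 3 → ∀ e ∈ d, ∀ a, ∑ b, N a b * (∑ k, A k b * B k e) = 0) :
    coeff (∑ a ∈ (∅ : Finset (Fin h)), Finsupp.single (Fin.castAdd h a) 1 + ∑ c ∈ d, Finsupp.single (Fin.natAdd h c) 1)
        (∑ k : Fin (h + h), ∑ k' : Fin (h + h), C ((∑ a, ∑ b, A k a * N a b * A k' b) / 2) *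
          (((∑ S ∈ (Finset.univ : Finset (Fin h)).powerset,
            monomial (∑ a ∈ (∅ : Finset (Fin h)), Finsupp.single (Fin.castAdd h a) 1 +
              ∑ c ∈ S, Finsupp.single (Fin.natAdd h c) 1)
              ((-1 : ℂ) ^ S.card * (S.card.factorial : ℂ) * ∏ c ∈ S, B k c)) - 1) * ((∑ S ∈ (Finset.univ : Finset (Fin h)).powerset,
            monomial (∑ a ∈ (∅ : Finset (Fin h)), Finsupp.single (Fin.castAdd h a) 1 +
              ∑ c ∈ S, Finsupp.single (Fin.natAdd h c) 1)
              ((-1 : ℂ) ^ S.card * (S.card.factorial : ℂ) * ∏ c ∈ S, B k' c)) - 1))) = 0 := by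
  classical
  rw [coeff_sum]
  simp_rw [coeff_sum, coeff_C_mul]
  rcases Nat.lt_or_ge d.card 2 with hlt | hge
  · -- `|d| ≤ 1`: every term vanishes
    refine Finset.sum_eq_zero fun k _ => Finset.sum_eq_zero fun k' _ => ?_
    rw [coeff_mul_of_noConst_card_le_one _ _ (support_tinv_sub_one (B k'))
      (by rw [coeff_tinv_sub_one, if_pos rfl]) (by rw [coeff_tinv_sub_one, if_pos rfl]) d (by omega),
      mul_zero]
  rcases Nat.lt_or_ge d.card 3 with hlt3 | hge3
  · -- `|d| = 2`
    have hd2 : d.card = 2 := by omega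
    have hterm : ∀ k k' : Fin (h + h),
        coeff (∑ a ∈ (∅ : Finset (Fin h)), Finsupp.single (Fin.castAdd h a) 1 + ∑ c ∈ d, Finsupp.single (Fin.natAdd h c) 1) (((∑ S ∈ (Finset.univ : Finset (Fin h)).powerset,
            monomial (∑ a ∈ (∅ : Finset (Fin h)), Finsupp.single (Fin.castAdd h a) 1 +
              ∑ c ∈ S, Finsupp.single (Fin.natAdd h c) 1)
              ((-1 : ℂ) ^ S.card * (S.card.factorial : ℂ) * ∏ c ∈ S, B k c)) - 1) * ((∑ S ∈ (Finset.univ : Finset (Fin h)).powerset,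
            monomial (∑ a ∈ (∅ : Finset (Fin h)), Finsupp.single (Fin.castAdd h a) 1 +
              ∑ c ∈ S, Finsupp.single (Fin.natAdd h c) 1)
              ((-1 : ℂ) ^ S.card * (S.card.factorial : ℂ) * ∏ c ∈ S, B k' c)) - 1)) =
          ∑ c ∈ d, (∏ x ∈ d.erase c, B k x) * B k' c := by
      intro k k'
      rw [coeff_mul_of_noConst_card_two _ _ (support_tinv_sub_one (B k'))
        (by rw [coeff_tinv_sub_one, if_pos rfl]) (by rw [coeff_tinv_sub_one, if_pos rfl]) d hd2]
      refine Finset.sum_congr rfl fun c hc => ?_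
      have hne : d.erase c ≠ ∅ := by
        intro he
        have := Finset.card_erase_of_mem hc
        rw [he, Finset.card_empty, hd2] at this
        omega
      rw [coeff_tinv_sub_one, if_neg hne, coeff_tinv_sub_one, if_neg (Finset.singleton_ne_empty c),
        Finset.card_erase_of_mem hc, hd2, Finset.card_singleton, Finset.prod_singleton]
      norm_num
    simp_rw [hterm, Finset.mul_sum]
    -- move the sum over `c ∈ d` outside
    rw [Finset.sum_congr rfl fun k _ => Finset.sum_comm, Finset.sum_comm]
    refine Finset.sum_eq_zero fun c hc => ?_
    -- `d.erase c = {c̄}`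
    have hc1 : (d.erase c).card = 1 := by rw [Finset.card_erase_of_mem hc, hd2]
    obtain ⟨cb, hcb⟩ := Finset.card_eq_one.mp hc1
    have hcbd : cb ∈ d.erase c := by rw [hcb]; exact Finset.mem_singleton_self cb
    have hcbne : cb ≠ c := Finset.ne_of_mem_erase hcbd
    have hcbmem : cb ∈ d := Finset.mem_of_mem_erase hcbd
    simp_rw [hcb, Finset.prod_singleton]
    have e3 : ∀ k k' : Fin (h + h), (∑ a, ∑ b, A k a * N a b * A k' b) / 2 * (B k cb * B k' c) =
        ((∑ a, ∑ b, A k a * N a b * A k' b) * B k cb * B k' c) / 2 := by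
      intro k k'; ring
    simp_rw [e3, ← Finset.sum_div]
    have e4 := sum_nu_mul_mul A N (fun k => B k cb) (fun k => B k c)
    rw [e4, hpair cb hcbmem c hc hcbne, zero_div]
  · -- `|d| = 3`
    have hd3 : d.card = 3 := by omega
    have hterm : ∀ k k' : Fin (h + h),
        coeff (∑ a ∈ (∅ : Finset (Fin h)), Finsupp.single (Fin.castAdd h a) 1 + ∑ c ∈ d, Finsupp.single (Fin.natAdd h c) 1) (((∑ S ∈ (Finset.univ : Finset (Fin h)).powerset,
            monomial (∑ a ∈ (∅ : Finset (Fin h)), Finsupp.single (Fin.castAdd h a) 1 +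
              ∑ c ∈ S, Finsupp.single (Fin.natAdd h c) 1)
              ((-1 : ℂ) ^ S.card * (S.card.factorial : ℂ) * ∏ c ∈ S, B k c)) - 1) * ((∑ S ∈ (Finset.univ : Finset (Fin h)).powerset,
            monomial (∑ a ∈ (∅ : Finset (Fin h)), Finsupp.single (Fin.castAdd h a) 1 +
              ∑ c ∈ S, Finsupp.single (Fin.natAdd h c) 1)
              ((-1 : ℂ) ^ S.card * (S.card.factorial : ℂ) * ∏ c ∈ S, B k' c)) - 1)) =
          ∑ c ∈ d, (-2) * ((∏ x ∈ d.erase c, B k x) * B k' c + B k c * ∏ x ∈ d.erase c, B k' x) := by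
      intro k k'
      rw [coeff_mul_of_noConst_card_three _ _ (support_tinv_sub_one (B k'))
        (by rw [coeff_tinv_sub_one, if_pos rfl]) (by rw [coeff_tinv_sub_one, if_pos rfl]) d hd3]
      refine Finset.sum_congr rfl fun c hc => ?_
      have hne : d.erase c ≠ ∅ := by
        intro he
        have := Finset.card_erase_of_mem hc
        rw [he, Finset.card_empty, hd3] at this
        omega
      rw [coeff_tinv_sub_one, if_neg hne, coeff_tinv_sub_one, if_neg (Finset.singleton_ne_empty c),
        coeff_tinv_sub_one, if_neg (Finset.singleton_ne_empty c), coeff_tinv_sub_one, if_neg hne,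
        Finset.card_erase_of_mem hc, hd3, Finset.card_singleton, Finset.prod_singleton,
        Finset.prod_singleton]
      norm_num
      ring
    simp_rw [hterm, Finset.mul_sum]
    rw [Finset.sum_congr rfl fun k _ => Finset.sum_comm, Finset.sum_comm]
    refine Finset.sum_eq_zero fun c hc => ?_
    have e3 : ∀ k k' : Fin (h + h), (∑ a, ∑ b, A k a * N a b * A k' b) / 2 *
        ((-2) * ((∏ x ∈ d.erase c, B k x) * B k' c + B k c * ∏ x ∈ d.erase c, B k' x)) =
        -(((∑ a, ∑ b, A k a * N a b * A k' b) * (∏ x ∈ d.erase c, B k x) * B k' c) +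
          ((∑ a, ∑ b, A k a * N a b * A k' b) * B k c * ∏ x ∈ d.erase c, B k' x)) := by
      intro k k'; ring
    simp_rw [e3, Finset.sum_neg_distrib, Finset.sum_add_distrib]
    have e4 := sum_nu_mul_mul A N (fun k => ∏ x ∈ d.erase c, B k x) (fun k => B k c)
    have e5 := sum_nu_mul_mul A N (fun k => B k c) (fun k => ∏ x ∈ d.erase c, B k x)
    rw [e4, e5, sum_N_mul_eq_zero_right N _ _ (htrip hd3 c hc),
      sum_N_mul_eq_zero_left N hNsym _ _ (htrip hd3 c hc), add_zero, neg_zero]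


/-! ## 6. `Z` is `y`-only; the expansion of `coeff (E ∅ T) (F · Z)` -/

/-- `Z` involves no `x`-variable. -/
theorem support_Z (A B : Fin (h + h) → Fin h → ℂ) (N : Fin h → Fin h → ℂ) :
    ∀ s ∈ ((∑ k : Fin (h + h), ∑ k' : Fin (h + h), C ((∑ a, ∑ b, A k a * N a b * A k' b) / 2) *
          (((∑ S ∈ (Finset.univ : Finset (Fin h)).powerset,
            monomial (∑ a ∈ (∅ : Finset (Fin h)), Finsupp.single (Fin.castAdd h a) 1 +
              ∑ c ∈ S, Finsupp.single (Fin.natAdd h c) 1)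
              ((-1 : ℂ) ^ S.card * (S.card.factorial : ℂ) * ∏ c ∈ S, B k c)) - 1) * ((∑ S ∈ (Finset.univ : Finset (Fin h)).powerset,
            monomial (∑ a ∈ (∅ : Finset (Fin h)), Finsupp.single (Fin.castAdd h a) 1 +
              ∑ c ∈ S, Finsupp.single (Fin.natAdd h c) 1)
              ((-1 : ℂ) ^ S.card * (S.card.factorial : ℂ) * ∏ c ∈ S, B k' c)) - 1))) : MvPolynomial (Fin (h + h)) ℂ).support, ∀ a : Fin h, s (Fin.castAdd h a) = 0 := by
  classical
  refine support_castAdd_eq_zero_of_vars _ fun a ha => ?_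
  obtain ⟨k, -, hk⟩ := Finset.mem_biUnion.mp (vars_sum_subset _ _ ha)
  obtain ⟨k', -, hk'⟩ := Finset.mem_biUnion.mp (vars_sum_subset _ _ hk)
  rcases Finset.mem_union.mp (vars_mul _ _ hk') with h1 | h2
  · rw [vars_C] at h1
    exact Finset.notMem_empty _ h1
  · rcases Finset.mem_union.mp (vars_mul _ _ h2) with h3 | h3
    · have h4 : Fin.castAdd h a ∈ _ ∪ (1 : MvPolynomial (Fin (h + h)) ℂ).vars := vars_sub_subset _ h3
      rw [vars_one, Finset.union_empty] at h4
      exact castAdd_notMem_vars_tinv (B k) a h4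
    · have h4 : Fin.castAdd h a ∈ _ ∪ (1 : MvPolynomial (Fin (h + h)) ℂ).vars := vars_sub_subset _ h3
      rw [vars_one, Finset.union_empty] at h4
      exact castAdd_notMem_vars_tinv (B k') a h4

/-- The expansion `coeff (E ∅ T) (F · Z) = Σ_{k,k'} ν/2 · (X_{kk'} - Y_k - Y_{k'} + W)`. -/
theorem coeff_F_mul_Z (A B : Fin (h + h) → Fin h → ℂ) (N : Fin h → Fin h → ℂ) (T : Finset (Fin h)) :
    coeff (∑ a ∈ (∅ : Finset (Fin h)), Finsupp.single (Fin.castAdd h a) 1 + ∑ c ∈ T, Finsupp.single (Fin.natAdd h c) 1) ((∏ j, ((1 + ∑ c, C (B j c) * X (Fin.natAdd h c)) : MvPolynomial (Fin (h + h)) ℂ)) * (∑ k : Fin (h + h), ∑ k' : Fin (h + h), C ((∑ a, ∑ b, A k a * N a b * A k' b) / 2) *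
          (((∑ S ∈ (Finset.univ : Finset (Fin h)).powerset,
            monomial (∑ a ∈ (∅ : Finset (Fin h)), Finsupp.single (Fin.castAdd h a) 1 +
              ∑ c ∈ S, Finsupp.single (Fin.natAdd h c) 1)
              ((-1 : ℂ) ^ S.card * (S.card.factorial : ℂ) * ∏ c ∈ S, B k c)) - 1) * ((∑ S ∈ (Finset.univ : Finset (Fin h)).powerset,
            monomial (∑ a ∈ (∅ : Finset (Fin h)), Finsupp.single (Fin.castAdd h a) 1 +
              ∑ c ∈ S, Finsupp.single (Fin.natAdd h c) 1)
              ((-1 : ℂ) ^ S.card * (S.card.factorial : ℂ) * ∏ c ∈ S, B k' c)) - 1)))) =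
      ∑ k : Fin (h + h), ∑ k' : Fin (h + h), (∑ a, ∑ b, A k a * N a b * A k' b) / 2 *
        (coeff (∑ a ∈ (∅ : Finset (Fin h)), Finsupp.single (Fin.castAdd h a) 1 + ∑ c ∈ T, Finsupp.single (Fin.natAdd h c) 1) ((∏ j, ((1 + ∑ c, C (B j c) * X (Fin.natAdd h c)) : MvPolynomial (Fin (h + h)) ℂ)) * ((∑ S ∈ (Finset.univ : Finset (Fin h)).powerset,
            monomial (∑ a ∈ (∅ : Finset (Fin h)), Finsupp.single (Fin.castAdd h a) 1 +
              ∑ c ∈ S, Finsupp.single (Fin.natAdd h c) 1)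
              ((-1 : ℂ) ^ S.card * (S.card.factorial : ℂ) * ∏ c ∈ S, B k c)) * (∑ S ∈ (Finset.univ : Finset (Fin h)).powerset,
            monomial (∑ a ∈ (∅ : Finset (Fin h)), Finsupp.single (Fin.castAdd h a) 1 +
              ∑ c ∈ S, Finsupp.single (Fin.natAdd h c) 1)
              ((-1 : ℂ) ^ S.card * (S.card.factorial : ℂ) * ∏ c ∈ S, B k' c)))) - coeff (∑ a ∈ (∅ : Finset (Fin h)), Finsupp.single (Fin.castAdd h a) 1 + ∑ c ∈ T, Finsupp.single (Fin.natAdd h c) 1) ((∏ j, ((1 + ∑ c, C (B j c) * X (Fin.natAdd h c)) : MvPolynomial (Fin (h + h)) ℂ)) * (∑ S ∈ (Finset.univ : Finset (Fin h)).powerset,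
            monomial (∑ a ∈ (∅ : Finset (Fin h)), Finsupp.single (Fin.castAdd h a) 1 +
              ∑ c ∈ S, Finsupp.single (Fin.natAdd h c) 1)
              ((-1 : ℂ) ^ S.card * (S.card.factorial : ℂ) * ∏ c ∈ S, B k c))) - coeff (∑ a ∈ (∅ : Finset (Fin h)), Finsupp.single (Fin.castAdd h a) 1 + ∑ c ∈ T, Finsupp.single (Fin.natAdd h c) 1) ((∏ j, ((1 + ∑ c, C (B j c) * X (Fin.natAdd h c)) : MvPolynomial (Fin (h + h)) ℂ)) * (∑ S ∈ (Finset.univ : Finset (Fin h)).powerset,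
            monomial (∑ a ∈ (∅ : Finset (Fin h)), Finsupp.single (Fin.castAdd h a) 1 +
              ∑ c ∈ S, Finsupp.single (Fin.natAdd h c) 1)
              ((-1 : ℂ) ^ S.card * (S.card.factorial : ℂ) * ∏ c ∈ S, B k' c))) + coeff (∑ a ∈ (∅ : Finset (Fin h)), Finsupp.single (Fin.castAdd h a) 1 + ∑ c ∈ T, Finsupp.single (Fin.natAdd h c) 1) (∏ j, ((1 + ∑ c, C (B j c) * X (Fin.natAdd h c)) : MvPolynomial (Fin (h + h)) ℂ))) := by
  classical
  rw [Finset.mul_sum, coeff_sum]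
  refine Finset.sum_congr rfl fun k _ => ?_
  rw [Finset.mul_sum, coeff_sum]
  refine Finset.sum_congr rfl fun k' _ => ?_
  rw [mul_left_comm, coeff_C_mul, mul_sub, mul_sub, mul_one, sub_mul, one_mul, mul_sub, mul_sub,
    coeff_sub, coeff_sub, coeff_sub]
  ring

/-! ## 8. The row-dependence certificate -/

/-- **The row-dependence certificate.**  For forms with constant `1`, `x`-coefficients `A` and
`y`-coefficients `B`, any symmetric zero-diagonal `N` with `Σ_{a,b} A k a N a b A k b = 0` (all `k`),
and a column `T` with `|T| ≤ 3` satisfying the pair condition `Σ N 𝕄 𝕄 = 0` on distinct `c, c' ∈ T`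
and, when `|T| = 3`, `N 𝕄_e = 0` for `e ∈ T`: the thin rows of the partition matrix of `∏ ℓ`,
weighted by `λ_∅ = ½ Σ ν`, `λ_a = -Σ_b N a b Σ_j A j b`, `λ_{ab} = ½ N a b`, sum to zero on `T`. -/
theorem thinRows_certificate (A B : Fin (h + h) → Fin h → ℂ) (N : Fin h → Fin h → ℂ)
    (hNsym : ∀ a b, N a b = N b a) (hNdiag : ∀ a, N a a = 0)
    (hNiso : ∀ k, ∑ a, ∑ b, A k a * N a b * A k b = 0)
    (T : Finset (Fin h)) (hT : T.card ≤ 3)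
    (hpair : ∀ c ∈ T, ∀ c' ∈ T, c ≠ c' →
      ∑ a, ∑ b, N a b * (∑ k, A k a * B k c) * (∑ k, A k b * B k c') = 0)
    (htrip : T.card = 3 → ∀ e ∈ T, ∀ a, ∑ b, N a b * (∑ k, A k b * B k e) = 0) :
    (∑ k : Fin (h + h), ∑ k' : Fin (h + h), (∑ a, ∑ b, A k a * N a b * A k' b)) / 2 * coeff (∑ a ∈ (∅ : Finset (Fin h)), Finsupp.single (Fin.castAdd h a) 1 + ∑ c ∈ T, Finsupp.single (Fin.natAdd h c) 1) (∏ k, ((C 1 + ∑ a, C (A k a) * X (Fin.castAdd h a) + ∑ c, C (B k c) * X (Fin.natAdd h c)) : MvPolynomial (Fin (h + h)) ℂ)) +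
      ∑ a, (-(∑ b, N a b * ∑ j, A j b)) * coeff (∑ a' ∈ ({a} : Finset (Fin h)), Finsupp.single (Fin.castAdd h a') 1 + ∑ c ∈ T, Finsupp.single (Fin.natAdd h c) 1) (∏ k, ((C 1 + ∑ a, C (A k a) * X (Fin.castAdd h a) + ∑ c, C (B k c) * X (Fin.natAdd h c)) : MvPolynomial (Fin (h + h)) ℂ)) +
      ∑ a, ∑ b ∈ Finset.univ.erase a, N a b / 2 * coeff (∑ a' ∈ ({a, b} : Finset (Fin h)), Finsupp.single (Fin.castAdd h a') 1 + ∑ c ∈ T, Finsupp.single (Fin.natAdd h c) 1) (∏ k, ((C 1 + ∑ a, C (A k a) * X (Fin.castAdd h a) + ∑ c, C (B k c) * X (Fin.natAdd h c)) : MvPolynomial (Fin (h + h)) ℂ)) = 0 := by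
  classical
  -- Step 1: the row formulas and the truncated inverses
  rw [coeff_empty_prodForms A B Finset.univ T]
  have h1 : ∀ a : Fin h, coeff (∑ a' ∈ ({a} : Finset (Fin h)), Finsupp.single (Fin.castAdd h a') 1 + ∑ c ∈ T, Finsupp.single (Fin.natAdd h c) 1) (∏ k, ((C 1 + ∑ a, C (A k a) * X (Fin.castAdd h a) + ∑ c, C (B k c) * X (Fin.natAdd h c)) : MvPolynomial (Fin (h + h)) ℂ)) = ∑ k, A k a * coeff (∑ a ∈ (∅ : Finset (Fin h)), Finsupp.single (Fin.castAdd h a) 1 + ∑ c ∈ T, Finsupp.single (Fin.natAdd h c) 1) ((∏ j, ((1 + ∑ c, C (B j c) * X (Fin.natAdd h c)) : MvPolynomial (Fin (h + h)) ℂ)) * (∑ S ∈ (Finset.univ : Finset (Fin h)).powerset,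
            monomial (∑ a ∈ (∅ : Finset (Fin h)), Finsupp.single (Fin.castAdd h a) 1 +
              ∑ c ∈ S, Finsupp.single (Fin.natAdd h c) 1)
              ((-1 : ℂ) ^ S.card * (S.card.factorial : ℂ) * ∏ c ∈ S, B k c))) := by
    intro a
    rw [coeff_single_prodForms A B Finset.univ a T]
    exact Finset.sum_congr rfl fun k _ => by rw [coeff_leaveOneOut_eq_tinv B k T]
  have h2 : ∀ a b : Fin h, a ≠ b → coeff (∑ a' ∈ ({a, b} : Finset (Fin h)), Finsupp.single (Fin.castAdd h a') 1 + ∑ c ∈ T, Finsupp.single (Fin.natAdd h c) 1) (∏ k, ((C 1 + ∑ a, C (A k a) * X (Fin.castAdd h a) + ∑ c, C (B k c) * X (Fin.natAdd h c)) : MvPolynomial (Fin (h + h)) ℂ)) =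
      ∑ k, ∑ k' ∈ Finset.univ.erase k, A k a * A k' b * coeff (∑ a ∈ (∅ : Finset (Fin h)), Finsupp.single (Fin.castAdd h a) 1 + ∑ c ∈ T, Finsupp.single (Fin.natAdd h c) 1) ((∏ j, ((1 + ∑ c, C (B j c) * X (Fin.natAdd h c)) : MvPolynomial (Fin (h + h)) ℂ)) * ((∑ S ∈ (Finset.univ : Finset (Fin h)).powerset,
            monomial (∑ a ∈ (∅ : Finset (Fin h)), Finsupp.single (Fin.castAdd h a) 1 +
              ∑ c ∈ S, Finsupp.single (Fin.natAdd h c) 1)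
              ((-1 : ℂ) ^ S.card * (S.card.factorial : ℂ) * ∏ c ∈ S, B k c)) * (∑ S ∈ (Finset.univ : Finset (Fin h)).powerset,
            monomial (∑ a ∈ (∅ : Finset (Fin h)), Finsupp.single (Fin.castAdd h a) 1 +
              ∑ c ∈ S, Finsupp.single (Fin.natAdd h c) 1)
              ((-1 : ℂ) ^ S.card * (S.card.factorial : ℂ) * ∏ c ∈ S, B k' c)))) := by
    intro a b hab
    rw [coeff_pair_prodForms A B Finset.univ a b hab T]
    exact Finset.sum_congr rfl fun k _ => Finset.sum_congr rfl fun k' hk' => by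
      rw [coeff_leaveTwoOut_eq_tinv B k k' (Finset.ne_of_mem_erase hk') T]
  simp_rw [h1]
  have h2' : ∑ a, ∑ b ∈ Finset.univ.erase a, N a b / 2 * coeff (∑ a' ∈ ({a, b} : Finset (Fin h)), Finsupp.single (Fin.castAdd h a') 1 + ∑ c ∈ T, Finsupp.single (Fin.natAdd h c) 1) (∏ k, ((C 1 + ∑ a, C (A k a) * X (Fin.castAdd h a) + ∑ c, C (B k c) * X (Fin.natAdd h c)) : MvPolynomial (Fin (h + h)) ℂ)) =
      ∑ a, ∑ b ∈ Finset.univ.erase a, N a b / 2 *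
        ∑ k, ∑ k' ∈ Finset.univ.erase k, A k a * A k' b * coeff (∑ a ∈ (∅ : Finset (Fin h)), Finsupp.single (Fin.castAdd h a) 1 + ∑ c ∈ T, Finsupp.single (Fin.natAdd h c) 1) ((∏ j, ((1 + ∑ c, C (B j c) * X (Fin.natAdd h c)) : MvPolynomial (Fin (h + h)) ℂ)) * ((∑ S ∈ (Finset.univ : Finset (Fin h)).powerset,
            monomial (∑ a ∈ (∅ : Finset (Fin h)), Finsupp.single (Fin.castAdd h a) 1 +
              ∑ c ∈ S, Finsupp.single (Fin.natAdd h c) 1)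
              ((-1 : ℂ) ^ S.card * (S.card.factorial : ℂ) * ∏ c ∈ S, B k c)) * (∑ S ∈ (Finset.univ : Finset (Fin h)).powerset,
            monomial (∑ a ∈ (∅ : Finset (Fin h)), Finsupp.single (Fin.castAdd h a) 1 +
              ∑ c ∈ S, Finsupp.single (Fin.natAdd h c) 1)
              ((-1 : ℂ) ^ S.card * (S.card.factorial : ℂ) * ∏ c ∈ S, B k' c)))) :=
    Finset.sum_congr rfl fun a _ => Finset.sum_congr rfl fun b hb => by
      rw [h2 a b (Finset.ne_of_mem_erase hb).symm]
  rw [h2']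
  -- Step 2: the target is `coeff (E ∅ T) (F · Z) = 0`
  have hZ0 : coeff (∑ a ∈ (∅ : Finset (Fin h)), Finsupp.single (Fin.castAdd h a) 1 + ∑ c ∈ T, Finsupp.single (Fin.natAdd h c) 1) ((∏ j, ((1 + ∑ c, C (B j c) * X (Fin.natAdd h c)) : MvPolynomial (Fin (h + h)) ℂ)) * (∑ k : Fin (h + h), ∑ k' : Fin (h + h), C ((∑ a, ∑ b, A k a * N a b * A k' b) / 2) *
          (((∑ S ∈ (Finset.univ : Finset (Fin h)).powerset,
            monomial (∑ a ∈ (∅ : Finset (Fin h)), Finsupp.single (Fin.castAdd h a) 1 +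
              ∑ c ∈ S, Finsupp.single (Fin.natAdd h c) 1)
              ((-1 : ℂ) ^ S.card * (S.card.factorial : ℂ) * ∏ c ∈ S, B k c)) - 1) * ((∑ S ∈ (Finset.univ : Finset (Fin h)).powerset,
            monomial (∑ a ∈ (∅ : Finset (Fin h)), Finsupp.single (Fin.castAdd h a) 1 +
              ∑ c ∈ S, Finsupp.single (Fin.natAdd h c) 1)
              ((-1 : ℂ) ^ S.card * (S.card.factorial : ℂ) * ∏ c ∈ S, B k' c)) - 1)))) = 0 := by
    rw [coeff_partitionExpo_mul_yOnly _ _ (support_Z A B N) ∅ T]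
    refine Finset.sum_eq_zero fun d hd => ?_
    have hdT : d ⊆ T := Finset.mem_powerset.mp hd
    have hdc : d.card ≤ 3 := (Finset.card_le_card hdT).trans hT
    rw [coeff_Z_eq_zero A B N hNsym d hdc (fun c hc c' hc' hne => hpair c (hdT hc) c' (hdT hc') hne)
      (fun hd3 => ?_), mul_zero]
    have hdeq : d = T := Finset.eq_of_subset_of_card_le hdT (by omega)
    intro e he a
    exact htrip (by rw [← hdeq]; exact hd3) e (hdeq ▸ he) a
  have key := certificate_algebra A N hNsym hNdiag hNiso (coeff (∑ a ∈ (∅ : Finset (Fin h)), Finsupp.single (Fin.castAdd h a) 1 + ∑ c ∈ T, Finsupp.single (Fin.natAdd h c) 1) (∏ j, ((1 + ∑ c, C (B j c) * X (Fin.natAdd h c)) : MvPolynomial (Fin (h + h)) ℂ)))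
    (fun k => coeff (∑ a ∈ (∅ : Finset (Fin h)), Finsupp.single (Fin.castAdd h a) 1 + ∑ c ∈ T, Finsupp.single (Fin.natAdd h c) 1) ((∏ j, ((1 + ∑ c, C (B j c) * X (Fin.natAdd h c)) : MvPolynomial (Fin (h + h)) ℂ)) * (∑ S ∈ (Finset.univ : Finset (Fin h)).powerset,
            monomial (∑ a ∈ (∅ : Finset (Fin h)), Finsupp.single (Fin.castAdd h a) 1 +
              ∑ c ∈ S, Finsupp.single (Fin.natAdd h c) 1)
              ((-1 : ℂ) ^ S.card * (S.card.factorial : ℂ) * ∏ c ∈ S, B k c))))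
    (fun k k' => coeff (∑ a ∈ (∅ : Finset (Fin h)), Finsupp.single (Fin.castAdd h a) 1 + ∑ c ∈ T, Finsupp.single (Fin.natAdd h c) 1) ((∏ j, ((1 + ∑ c, C (B j c) * X (Fin.natAdd h c)) : MvPolynomial (Fin (h + h)) ℂ)) * ((∑ S ∈ (Finset.univ : Finset (Fin h)).powerset,
            monomial (∑ a ∈ (∅ : Finset (Fin h)), Finsupp.single (Fin.castAdd h a) 1 +
              ∑ c ∈ S, Finsupp.single (Fin.natAdd h c) 1)
              ((-1 : ℂ) ^ S.card * (S.card.factorial : ℂ) * ∏ c ∈ S, B k c)) * (∑ S ∈ (Finset.univ : Finset (Fin h)).powerset,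
            monomial (∑ a ∈ (∅ : Finset (Fin h)), Finsupp.single (Fin.castAdd h a) 1 +
              ∑ c ∈ S, Finsupp.single (Fin.natAdd h c) 1)
              ((-1 : ℂ) ^ S.card * (S.card.factorial : ℂ) * ∏ c ∈ S, B k' c)))))
  rw [key, ← coeff_F_mul_Z A B N T, hZ0]

end Summit.ValiantsHypothesis.ValiantsHypothesis.Theorems.BarrierLever.ChowStarve
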